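import Mathlib.LinearAlgebra.Matrix.Rank
import Literature.Computability.AlgebraicComplexity.OneOneOneEquations
import HarnessLib

/-!
# The 111-equations as a kernel-checkable border-rank certificate (Jelisiejew–Landsberg–Pal 2023, §1) — matrix form

Topic `Literature/Computability/AlgebraicComplexity`; companion of `OneOneOneEquations.lean` (the
criterion `dim 𝔞(t) < N ⟹ N < bR(t)` for concise `N × N × N` tensors, Buczyńska–Buczyński 2021,
Thm. 1.2 / Jelisiejew–Landsberg–Pal 2023, §1) and of the integer row-certificate tool
`LinearAlgebra/Matrix/IntRowCertificate.lean`.  It turns the criterion into a statement about RANKS OF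
EXPLICIT MATRICES with computable entries, so that an instance is certified in the kernel by
`decide` on integer row-operation certificates:

* `slab₁ t : Matrix Z (X × Y) R`, the first flattening (`(z; x, y) ↦ t z x y`); conciseness of a leg is
  `|Z| ≤ rank (slab₁ t)` (`linearIndependent_of_card_le_rank_slab₁`), the other legs via `rotate`;
* `matrix111 t : Matrix ((Z × X × Y) ⊕ (Z × X × Y)) ((Z × Z) ⊕ (X × X) ⊕ (Y × Y)) R`, the matrix of
  the 111-map `(P, Q, R) ↦ (P ·₁ t - Q ·₂ t, Q ·₂ t - R ·₃ t)` in the standard bases (entries `0`,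
  `± t z x y`, no sums), with `matrix111_mulVec` and `rank_matrix111 : rank (matrix111 t) =
  dim range (lin111 t)`; base change `slab₁_map`, `matrix111_map`;
* `lt_algBorderRank_of_rank_slab_matrix111` — over a field: `|Z| = |X| = |Y| = N`, the three slabs of
  rank `≥ N` and `3N² - N < rank (matrix111 t)` imply `N < bR(t)`;
* `lt_algBorderRank_intCast_of_rank` — the same for an INTEGER tensor read in a field of
  characteristic zero, hypotheses on the ranks of the base-changed integer matrices: exactly the shape
  delivered by `Literature.LinearAlgebra.Matrix.le_rank_of_intTriCheck`;
* coders `finCode`, `rowCode111`, `colCode111`, `slabColCode` (`ℕ →` index types of a cubic format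
  `Fin n`) and `supportTensor n S` (the all-ones tensor on a support `S ⊆ [n]³`, as an integer tensor),
  shared by the instance files.

Everything here is PROVED (no named facts).  HONEST FRAMING (pub-tensor bundle, VALUE.md §1): this is
the kernel form of the bundle's `numerics/eq111.py` layer — certified tables / decidable verdicts /
certificates for toy tensors, NOT summit progress on `ω` (`P(ω ≤ 2.3 this quarter) < 1 %`).

## References

* J. Jelisiejew, J. M. Landsberg, A. Pal, *Concise tensors of minimal border rank*, Math. Ann. (2023),
  arXiv:2205.05713, §1, p. 4 (the 111-map and its rank bound `3m² - m`). [JelisiejewLandsbergPal2023]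
* W. Buczyńska, J. Buczyński, Duke Math. J. 170 (2021), Thm. 1.2. [BuczynskaBuczynski2021]
-/

open scoped BigOperators Matrix
open Matrix

namespace Literature.Computability.AlgebraicComplexity

universe u

/-! ## The flattening matrix of the first leg -/

section Slab

variable {R : Type*} {Z X Y : Type*}

/-- The first flattening `slab₁ t : R^Z → R^{X × Y}` as a matrix, `(slab₁ t) z (x, y) = t z x y`.
[cite: JelisiejewLandsbergPal2023, §1 (p. 4)] -/
def slab₁ (t : Z → X → Y → R) : Matrix Z (X × Y) R :=
  Matrix.of fun z p => t z p.1 p.2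

/-- Entries of `slab₁`. [folklore] -/
@[simp] theorem slab₁_apply (t : Z → X → Y → R) (z : Z) (p : X × Y) : slab₁ t z p = t z p.1 p.2 := rfl

/-- Base change of `slab₁`. [folklore] -/
theorem slab₁_map [CommRing R] {S : Type*} [CommRing S] (f : R →+* S) (t : Z → X → Y → R) :
    (slab₁ t).map f = slab₁ (fun z x y => f (t z x y)) := rfl

end Slab

section SlabRank

variable {K : Type u} [Field K] {Z X Y : Type*} [Fintype Z] [Fintype X] [Fintype Y]

/-- **Conciseness from the flattening rank**: if `|Z| ≤ rank (slab₁ t)` then the slices `(t z)_z` are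
linearly independent (the first leg of `t` is concise). [folklore] -/
theorem linearIndependent_of_card_le_rank_slab₁ (t : Z → X → Y → K)
    (h : Fintype.card Z ≤ (slab₁ t).rank) : LinearIndependent K fun z => t z := by
  classical
  rw [Matrix.rank_eq_finrank_span_row] at h
  have hrow : LinearIndependent K (slab₁ t).row :=
    linearIndependent_iff_card_le_finrank_span.2 (by simpa [Set.finrank] using h)
  have e : (fun z => t z) = (LinearEquiv.curry K K X Y).toLinearMap ∘ (slab₁ t).row := by
    funext z x y
    rfl
  rw [e]
  exact hrow.map' _ (LinearEquiv.ker _)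

end SlabRank

/-! ## The matrix of the 111-map -/

section Matrix111

variable {R : Type*} [CommRing R] {Z X Y : Type*} [DecidableEq Z] [DecidableEq X] [DecidableEq Y]

/-- Entries of the 111-matrix: row `inl (z,x,y)` is the `(z,x,y)`-coordinate of `P ·₁ t - Q ·₂ t`, row
`inr (z,x,y)` that of `Q ·₂ t - R ·₃ t`; column `inl (z₀,z₁)` is the matrix unit `P = E_{z₀ z₁}`,
`inr (inl (x₀,x₁))` is `Q = E_{x₀ x₁}`, `inr (inr (y₀,y₁))` is `R = E_{y₀ y₁}`.
[cite: JelisiejewLandsbergPal2023, §1 (p. 4)] -/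
def entry111 (t : Z → X → Y → R) : (Z × X × Y) ⊕ (Z × X × Y) → TripleIndex Z X Y → R
  | Sum.inl (z, x, y), Sum.inl (z₀, z₁) => if z = z₀ then t z₁ x y else 0
  | Sum.inl (z, x, y), Sum.inr (Sum.inl (x₀, x₁)) => if x = x₀ then -t z x₁ y else 0
  | Sum.inl _, Sum.inr (Sum.inr _) => 0
  | Sum.inr _, Sum.inl _ => 0
  | Sum.inr (z, x, y), Sum.inr (Sum.inl (x₀, x₁)) => if x = x₀ then t z x₁ y else 0
  | Sum.inr (z, x, y), Sum.inr (Sum.inr (y₀, y₁)) => if y = y₀ then -t z x y₁ else 0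

/-- **The 111-matrix** of `t`: the matrix of `lin111 t` (`(P,Q,R) ↦ (P ·₁ t - Q ·₂ t, Q ·₂ t - R ·₃ t)`)
in the standard bases. [cite: JelisiejewLandsbergPal2023, §1 (p. 4)] -/
def matrix111 (t : Z → X → Y → R) : Matrix ((Z × X × Y) ⊕ (Z × X × Y)) (TripleIndex Z X Y) R :=
  Matrix.of (entry111 t)

/-- Base change of the 111-matrix. [folklore] -/
theorem matrix111_map {S : Type*} [CommRing S] (f : R →+* S) (t : Z → X → Y → R) :
    (matrix111 t).map f = matrix111 (fun z x y => f (t z x y)) := by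
  ext r j
  rcases r with ⟨z, x, y⟩ | ⟨z, x, y⟩ <;> rcases j with ⟨z₀, z₁⟩ | ⟨x₀, x₁⟩ | ⟨y₀, y₁⟩ <;>
    simp [matrix111, entry111, apply_ite f]

/-- The linear identification `(R^{Z×X×Y})² ≅ R^{(Z×X×Y) ⊔ (Z×X×Y)}` (uncurry and concatenate) used to
compare `lin111 t` with `matrix111 t`. [folklore] -/
def vec2 : ((Z → X → Y → R) × (Z → X → Y → R)) ≃ₗ[R] ((Z × X × Y) ⊕ (Z × X × Y) → R) where
  toFun fg := Sum.elim (fun p => fg.1 p.1 p.2.1 p.2.2) (fun p => fg.2 p.1 p.2.1 p.2.2)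
  invFun F := (fun z x y => F (Sum.inl (z, x, y)), fun z x y => F (Sum.inr (z, x, y)))
  map_add' fg fg' := by
    funext r
    rcases r with ⟨z, x, y⟩ | ⟨z, x, y⟩ <;> rfl
  map_smul' c fg := by
    funext r
    rcases r with ⟨z, x, y⟩ | ⟨z, x, y⟩ <;> rfl
  left_inv fg := rfl
  right_inv F := by
    funext r
    rcases r with ⟨z, x, y⟩ | ⟨z, x, y⟩ <;> rfl

variable [Fintype Z] [Fintype X] [Fintype Y]

/-- **`matrix111 t` is the matrix of `lin111 t`**: `matrix111 t · κ = vec2 (lin111 t κ)`. [folklore] -/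
theorem matrix111_mulVec (t : Z → X → Y → R) (κ : TripleIndex Z X Y → R) :
    (matrix111 t).mulVec κ = vec2 (lin111 t κ) := by
  funext r
  simp only [Matrix.mulVec, dotProduct, matrix111, Matrix.of_apply, Fintype.sum_sum_type,
    Fintype.sum_prod_type]
  rcases r with ⟨z, x, y⟩ | ⟨z, x, y⟩
  · simp [entry111, vec2, lin111, contract₁, contract₂, ite_mul, neg_mul, Finset.sum_ite_irrel,
      Finset.sum_ite_eq, Finset.sum_neg_distrib, mul_comm, sub_eq_add_neg]
  · simp [entry111, vec2, lin111, contract₂, contract₃, ite_mul, neg_mul, Finset.sum_ite_irrel,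
      Finset.sum_ite_eq, Finset.sum_neg_distrib, mul_comm, sub_eq_add_neg]

end Matrix111

section Matrix111Rank

variable {K : Type u} [Field K] {Z X Y : Type*} [Fintype Z] [Fintype X] [Fintype Y] [DecidableEq Z]
  [DecidableEq X] [DecidableEq Y]

/-- `mulVecLin (matrix111 t) = vec2 ∘ lin111 t`. [folklore] -/
theorem mulVecLin_matrix111 (t : Z → X → Y → K) :
    (matrix111 t).mulVecLin = (vec2 : _ ≃ₗ[K] ((Z × X × Y) ⊕ (Z × X × Y) → K)).toLinearMap ∘ₗ lin111 t := by
  apply LinearMap.ext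
  intro κ
  rw [Matrix.mulVecLin_apply, matrix111_mulVec]
  rfl

/-- **The rank of the 111-matrix is the rank of the 111-map.** [folklore] -/
theorem rank_matrix111 (t : Z → X → Y → K) :
    (matrix111 t).rank = Module.finrank K (LinearMap.range (lin111 t)) := by
  rw [Matrix.rank, mulVecLin_matrix111, LinearMap.range_comp]
  exact LinearEquiv.finrank_map_eq _ _

/-- **The 111-equations as a matrix-rank certificate** (over any field): a tensor of format
`N × N × N` whose three flattenings have rank `≥ N` (conciseness) and whose 111-matrix has rank
`> 3N² - N` has border rank `> N`. [cite: JelisiejewLandsbergPal2023, §1 (p. 4)] -/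
theorem lt_algBorderRank_of_rank_slab_matrix111 {N : ℕ} (t : Z → X → Y → K)
    (hcZ : Fintype.card Z = N) (hcX : Fintype.card X = N) (hcY : Fintype.card Y = N)
    (h₁ : N ≤ (slab₁ t).rank) (h₂ : N ≤ (slab₁ (rotate t)).rank)
    (h₃ : N ≤ (slab₁ (rotate (rotate t))).rank) (h111 : 3 * N ^ 2 - N < (matrix111 t).rank) :
    N < algBorderRank t := by
  refine lt_algBorderRank_of_lt_finrank_range_lin111 K t
    (linearIndependent_of_card_le_rank_slab₁ t (hcZ ▸ h₁))
    (linearIndependent_of_card_le_rank_slab₁ (rotate t) (hcX ▸ h₂))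
    (linearIndependent_of_card_le_rank_slab₁ (rotate (rotate t)) (hcY ▸ h₃)) hcZ hcX hcY ?_
  rwa [rank_matrix111] at h111

end Matrix111Rank

/-! ## Integer tensors read in a field -/

section IntCast

variable {F : Type u} [Field F] {Z X Y : Type*} [Fintype Z] [Fintype X] [Fintype Y]
  [DecidableEq Z] [DecidableEq X] [DecidableEq Y]

/-- **Integer 111-certificate.** For an integer tensor `t` of format `N × N × N` read in a field `F`:
if the base changes to `F` of the three integer flattening matrices have rank `≥ N` and that of the
integer 111-matrix has rank `> 3N² - N`, then `N < bR(t ⊗ F)`.  In characteristic zero the four rank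
hypotheses are exactly what `Literature.LinearAlgebra.Matrix.le_rank_of_intTriCheck` proves from a
`decide`d integer row-operation certificate. [cite: JelisiejewLandsbergPal2023, §1 (p. 4)] -/
theorem lt_algBorderRank_intCast_of_rank {N : ℕ} (t : Z → X → Y → ℤ)
    (hcZ : Fintype.card Z = N) (hcX : Fintype.card X = N) (hcY : Fintype.card Y = N)
    (h₁ : N ≤ ((slab₁ t).map (Int.cast : ℤ → F)).rank)
    (h₂ : N ≤ ((slab₁ (rotate t)).map (Int.cast : ℤ → F)).rank)
    (h₃ : N ≤ ((slab₁ (rotate (rotate t))).map (Int.cast : ℤ → F)).rank)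
    (h111 : 3 * N ^ 2 - N < ((matrix111 t).map (Int.cast : ℤ → F)).rank) :
    N < algBorderRank (fun z x y => (t z x y : F)) := by
  have e111 : (matrix111 t).map (Int.cast : ℤ → F) = matrix111 (fun z x y => (t z x y : F)) := by
    have h := matrix111_map (Int.castRingHom F) t
    rwa [Int.coe_castRingHom] at h
  rw [e111] at h111
  exact lt_algBorderRank_of_rank_slab_matrix111 _ hcZ hcX hcY h₁ h₂ h₃ h111

end IntCast

/-! ## Coders for cubic formats `Fin n` and support tensors (shared by the instance files) -/

section Coders

/-- `a mod n` as an element of `Fin n`. [folklore] -/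
def finCode (n : ℕ) [NeZero n] (a : ℕ) : Fin n := ⟨a % n, Nat.mod_lt _ (Nat.pos_of_ne_zero (NeZero.ne n))⟩

/-- Decode a triple `(a, b, c) ∈ [n]³` from its base-`n` code `(a·n + b)·n + c`. [folklore] -/
def tripleCode (n : ℕ) [NeZero n] (r : ℕ) : Fin n × Fin n × Fin n :=
  (finCode n (r / (n * n)), finCode n (r / n), finCode n r)

/-- Row decoder of the 111-matrix of a cubic tensor: codes `< n³` are the first block, codes
`n³ ≤ r < 2n³` the second. [folklore] -/
def rowCode111 (n : ℕ) [NeZero n] (r : ℕ) : (Fin n × Fin n × Fin n) ⊕ (Fin n × Fin n × Fin n) :=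
  if r < n * n * n then Sum.inl (tripleCode n r) else Sum.inr (tripleCode n (r - n * n * n))

/-- Column decoder of the 111-matrix: `P`-block codes `< n²`, `Q`-block `n² ≤ c < 2n²`, `R`-block
`2n² ≤ c < 3n²`, each pair `(i, j)` coded `i·n + j`. [folklore] -/
def colCode111 (n : ℕ) [NeZero n] (c : ℕ) : TripleIndex (Fin n) (Fin n) (Fin n) :=
  if c < n * n then Sum.inl (finCode n (c / n), finCode n c)
  else if c < 2 * (n * n) then Sum.inr (Sum.inl (finCode n ((c - n * n) / n), finCode n (c - n * n)))
  else Sum.inr (Sum.inr (finCode n ((c - 2 * (n * n)) / n), finCode n (c - 2 * (n * n))))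

/-- Column decoder of a slab: pair `(i, j)` coded `i·n + j`. [folklore] -/
def slabColCode (n : ℕ) [NeZero n] (c : ℕ) : Fin n × Fin n := (finCode n (c / n), finCode n c)

/-- The all-ones tensor on a support `S ⊆ [n]³` (list of triples), as an INTEGER tensor. [folklore] -/
def supportTensor (n : ℕ) (S : List (ℕ × ℕ × ℕ)) : Fin n → Fin n → Fin n → ℤ :=
  fun a b c => if (a.val, b.val, c.val) ∈ S then 1 else 0

/-- The all-ones support tensor read in a field: `1` on `S`, `0` elsewhere. [folklore] -/
theorem intCast_supportTensor {F : Type u} [Field F] (n : ℕ) (S : List (ℕ × ℕ × ℕ)) (a b c : Fin n) :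
    ((supportTensor n S a b c : ℤ) : F) = if (a.val, b.val, c.val) ∈ S then 1 else 0 := by
  unfold supportTensor
  split_ifs <;> simp

end Coders

end Literature.Computability.AlgebraicComplexity
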